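import Summits.QuantumFields.BalabanUV.Beta.GAN24.DerivativeRateTransferJensenMassFreeLogChart
import Mathlib.Analysis.Calculus.MeanValue

/-!
# `BalabanUV.Beta.GAN24.DerivativeRateTransferJensenMassFreeKarcherGauss` — binder row G-an2-4 ∕ (CONV-C), route R6 «VALUES, NOT DERIVATIVES», PART 79:
# THE GAUSS LEMMA FOR THE SMALL LOGARITHM — for real SKEW `A, E` (`‖A‖ ≤ 1∕100`, `‖E‖ ≤ 1∕50`) and the small logarithm `C = log(exp A·exp E)`:
#   `|½‖C‖² − ½‖A‖² − tr(AᵀE) − ½‖E‖²| ≤ 10·(‖A‖ + (3∕2)‖E‖)²·‖E‖²`   (Frobenius)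
# — the squared geodesic distance on the orthogonal group expanded to second order at a point `A ≠ 0` of the Lie algebra, with NO term linear in `E` beyond
# `tr(AᵀE)`: the Lie-algebra identity `tr(Cᵀ·g(ad C)Y) = tr(CᵀY)` (every `(ad C)ⁿY`, `n ≥ 1`, is a commutator with `C`, orthogonal to the normal matrix
# `C`), the derivative equation `g(ad f)f′ = E` of PART 78, and the mean value inequality twice (unit b2b-balaban-gan24-p3, gen 46; v1)

NOT IN PRINT; OUR PROOF (for the ROUTE; [folklore] — the Gauss lemma ∕ first variation of arc length for a bi-invariant metric on a compact Lie group (e.g.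
Milnor, *Morse theory* §21; Helgason Ch. II §1) BY NAME; here an elementary matrix proof: PART 78's chart and curve, the tree's `gSer` series
(`gSer_eq_tsum_neg_one_pow`, `summable_gSer_term'`, `norm_gSer_sub_one_le`, `norm_ad_le`, `ad_pow_succ_apply`), PART 66's trace toolkit, Mathlib's
`norm_image_sub_le_of_norm_deriv_le_segment'`, `HasDerivAt.mul`, `hasSum_single`, `HasSum.norm_le_of_bounded`).  HONEST FRAMING (cell contract, verbatim):
«discharging `BetaPertH` makes Bałaban's UV stability UNCONDITIONAL — a real constructive-QFT result; it is NOT the continuum limit and NOT the Clay problem.»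
HONEST DEPENDENCY (verbatim): «continuum YM on T⁴ ⇐ BetaPertH ∧ nine spine estimates (0/9 proved); BetaPertH ⇐ (D1) ∧ (D4) ∧ CAP+tail; G-an2-4 gates asym,
D1 and NE2/3/4.»

WHY THIS FILE.  Federbush's (1.27) [Erice 1985 p. 221] minimises `d(V) = Σ_x dist²(U(Γ_x), V)`, `dist` the geodesic distance; for the bi-invariant (Frobenius)
metric and nearby points `dist(U, V) = ‖log(UVᵀ)‖` BY NAME, so `d(V) = Σ_x q_x‖C_x(V)‖²` with `C_x(V)` the small skew logarithms of `τ_xVᵀ`.  Moving the base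
by a skew step `E` replaces `C_x` by `log(exp(C_x)exp(E))` (PART 80 §2), and the question «is the Karcher base (`Σ_x q_x•C_x = 0`, PART 77) the minimiser?» is
exactly the expansion of `½‖log(exp A·exp E)‖²` to second order in `E`.  THIS FILE proves it:
* §2 (Frobenius pairing `tr(XᵀY)`): `trace_tmul_comm_self` ∕ `trace_tmul_comm_of_normal` (a normal matrix is orthogonal to its commutators),
  `abs_trace_tmul_le` (Cauchy–Schwarz), `hasSum_gSer_apply`, **`trace_tmul_gSer_ad_apply`** — THE GAUSS LEMMA IN THE LIE ALGEBRA `tr(Cᵀ·g(ad C)Y) = tr(CᵀY)`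
  for normal `C` (the series term by term, `hasSum_single`), **`gauss_second_order`** — for normal `E`, `‖F‖ ≤ 1∕4`, `g(ad F)v = E`:
  `|tr(Eᵀ(v − E))| ≤ 10‖F‖²‖E‖²` (`v − E = (1 − g)E + (1 − g)(v − E)`; the first-order term `−½tr(Eᵀ[F,E])` VANISHES, the tail `Σ_{n≥2}` of the series is
  `≤ (4∕3)‖F‖²‖E‖²` by a geometric majorant, the second piece `≤ ‖1 − g‖·‖v − E‖·‖E‖ ≤ 8‖F‖²‖E‖²`).
* §3 **`half_normSq_log_expansion`**: with PART 78's curve `f(t) = log(exp A·exp(tE))` (skew on `[0,1]` by PART 69's uniqueness), `Φ₁(t) = ½‖f‖² − ½‖A‖² −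
  t·tr(AᵀE) − ½t²‖E‖²` has derivative `Ψ₁(t) = tr(Eᵀ(f − A − tE))` (product rule + `tr(fᵀf′) = tr(fᵀg(ad f)f′) = tr(fᵀE)`), `Ψ₁(0) = 0`,
  `|Ψ₁′| = |tr(Eᵀ(f′ − E))| ≤ 10‖f‖²‖E‖² ≤ 10(‖A‖ + (3∕2)‖E‖)²‖E‖²`; the mean value inequality bounds `|Ψ₁| ≤ K` and then `|Φ₁(1) − Φ₁(0)| ≤ K`.

HONEST SCOPE.  Crude constant `10` (truth: `‖E‖²·O(‖A‖² + ‖A‖‖E‖)` with small coefficients); real orthogonal group with the Frobenius metric only (U(N) ∕ SU(N)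
as closed subgroups inherit the statement for their skew-Hermitian logarithms — not spelled out); «geodesic distance = ‖small log‖» is BY NAME (Mathlib has no
Riemannian distance on matrix groups); windows `1∕100`, `1∕50`; NOT the tower, NOT (CONS), NOT (CONV-C).

WHAT THIS FILE PROVES (0 sorry, 0 `def`, nothing cited): §2 `trace_tmul_comm_self`, `trace_tmul_comm_of_normal`, `normal_of_skew`, `abs_trace_tmul_le`,
`hasSum_gSer_apply`, **`trace_tmul_gSer_ad_apply`**, **`gauss_second_order`**; §3 `trace_tmul_comm'`, **`half_normSq_log_expansion`**.
SUPPLIER work on route R6 (rank 2, REDUCTION, no seat); no consumer of record; NEVER «G-an2-4 closed»; NOT (CONV-C), NOT D1, NOT `BetaPertH`, NOT continuum,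
NOT Clay.  Records: `HOME/b2b-balaban-gan24-p3/WOODBURY-FIBRE.md` v14.6. -/

noncomputable section

open scoped NNReal Topology Nat
open NormedSpace Finset Metric Set Filter

namespace Summit.QuantumFields.BalabanUV.Beta.GAN24.DerivativeRateTransferJensenMassFreeKarcherGauss

open Literature.Analysis.Calculus.ExpDifferential
open Summit.QuantumFields.BalabanUV.Beta.GAN24.DerivativeRateTransferJensenMassFreeExpTaylor (norm_exp_sub_one_le)
open Summit.QuantumFields.BalabanUV.Beta.GAN24.DerivativeRateTransferJensenMassFreeLogarithm
open Summit.QuantumFields.BalabanUV.Beta.GAN24.DerivativeRateTransferJensenMassFreeKarcherContraction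
open Summit.QuantumFields.BalabanUV.Beta.GAN24.DerivativeRateTransferJensenMassFreeLogChart

/-! ## §2 Real matrices, Frobenius pairing: the Gauss lemma `⟨C, g(ad C)Y⟩ = ⟨C, Y⟩` and the second-order letter -/

section Frobenius

open scoped Matrix Matrix.Norms.Frobenius
open Matrix
open Summit.QuantumFields.BalabanUV.Beta.GAN24.DerivativeRateTransferJensenMassFreePolarNear

variable {o : Type*} [Fintype o] [DecidableEq o]

omit [DecidableEq o] in
/-- `tr(Cᵀ(CY − YC)) = 0` for a normal `C` (`CᵀC = CCᵀ`): the Frobenius pairing of `C` with a commutator `[C, Y]` vanishes. [folklore] -/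
theorem trace_tmul_comm_self {C : Matrix o o ℝ} (hC : Cᵀ * C = C * Cᵀ) (Y : Matrix o o ℝ) :
    Matrix.trace (Cᵀ * (C * Y - Y * C)) = 0 := by
  have h1 : Matrix.trace (Cᵀ * (C * Y)) = Matrix.trace (Cᵀ * C * Y) := by rw [Matrix.mul_assoc]
  have h2 : Matrix.trace (Cᵀ * (Y * C)) = Matrix.trace (Cᵀ * C * Y) := by
    rw [← Matrix.mul_assoc, Matrix.trace_mul_comm (Cᵀ * Y) C, ← Matrix.mul_assoc, hC]
  rw [Matrix.mul_sub, Matrix.trace_sub, h1, h2, sub_self]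

omit [DecidableEq o] in
/-- `tr(Eᵀ(FE − EF)) = 0` for a normal `E` and any `F`: the pairing of `E` with `[F, E]` vanishes. [folklore] -/
theorem trace_tmul_comm_of_normal {E : Matrix o o ℝ} (hE : Eᵀ * E = E * Eᵀ) (F : Matrix o o ℝ) :
    Matrix.trace (Eᵀ * (F * E - E * F)) = 0 := by
  have h1 : Matrix.trace (Eᵀ * (F * E)) = Matrix.trace (E * Eᵀ * F) := by
    rw [← Matrix.mul_assoc, Matrix.trace_mul_comm (Eᵀ * F) E, ← Matrix.mul_assoc]
  have h2 : Matrix.trace (Eᵀ * (E * F)) = Matrix.trace (E * Eᵀ * F) := by rw [← Matrix.mul_assoc, hE]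
  rw [Matrix.mul_sub, Matrix.trace_sub, h1, h2, sub_self]

omit [DecidableEq o] in
/-- skew matrices are normal. [folklore] -/
theorem normal_of_skew {C : Matrix o o ℝ} (hC : Cᵀ = -C) : Cᵀ * C = C * Cᵀ := by
  rw [hC, Matrix.neg_mul, Matrix.mul_neg]

/-- `|tr(EᵀX)| ≤ ‖E‖‖X‖` (Cauchy–Schwarz, PART 66). [folklore] -/
theorem abs_trace_tmul_le (E X : Matrix o o ℝ) : |Matrix.trace (Eᵀ * X)| ≤ ‖E‖ * ‖X‖ := by
  rw [abs_le]
  refine ⟨?_, trace_transpose_mul_le E X⟩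
  have h := trace_transpose_mul_le E (-X)
  rw [Matrix.mul_neg, Matrix.trace_neg, norm_neg] at h
  linarith

/-- the `g`-series of an operator `T`, applied to `Y`, as a `HasSum` in the printed form `Σ_n ((−1)ⁿ∕(n+1)!)·TⁿY` (the tree's `gSer_eq_tsum_neg_one_pow`
evaluated at `Y`). [cite tree: `ExpDifferential.gSer`] -/
theorem hasSum_gSer_apply (F Y : Matrix o o ℝ) :
    HasSum (fun n : ℕ => ((((-1 : ℝ) ^ n * ((n + 1)! : ℝ)⁻¹) • ad ℝ F ^ n) Y)) (gSer ℝ (ad ℝ F) Y) := by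
  have h := (ContinuousLinearMap.apply ℝ (Matrix o o ℝ) Y).hasSum (summable_gSer_term' (𝕂 := ℝ) (ad ℝ F)).hasSum
  rw [← gSer_eq_tsum_neg_one_pow] at h
  simp only [ContinuousLinearMap.apply_apply] at h
  exact h

/-- **`trace_tmul_gSer_ad_apply` — THE GAUSS LEMMA IN THE LIE ALGEBRA** [folklore; our proof]: for a normal `C` and every `Y`,
`tr(Cᵀ · g(ad C)Y) = tr(Cᵀ · Y)` — in the series `g(ad C)Y = Σ_n ((−1)ⁿ∕(n+1)!)(ad C)ⁿY` every term with `n ≥ 1` is a commutator `[C, ·]`, orthogonal to `C`. -/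
theorem trace_tmul_gSer_ad_apply {C : Matrix o o ℝ} (hC : Cᵀ * C = C * Cᵀ) (Y : Matrix o o ℝ) :
    Matrix.trace (Cᵀ * gSer ℝ (ad ℝ C) Y) = Matrix.trace (Cᵀ * Y) := by
  let ψ := LinearMap.toContinuousLinearMap ((Matrix.traceLinearMap o ℝ ℝ).comp (LinearMap.mulLeft ℝ Cᵀ))
  have hψ : ∀ X, ψ X = Matrix.trace (Cᵀ * X) := fun X => rfl
  set G : ℕ → ℝ := fun n => ψ ((((-1 : ℝ) ^ n * ((n + 1)! : ℝ)⁻¹) • ad ℝ C ^ n) Y) with hG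
  have hsum1 : HasSum G (ψ (gSer ℝ (ad ℝ C) Y)) := by exact ψ.hasSum (hasSum_gSer_apply C Y)
  have hzero : ∀ n, n ≠ 0 → G n = 0 := by
    intro n hn
    obtain ⟨m, rfl⟩ := Nat.exists_eq_add_one_of_ne_zero hn
    simp only [hG, _root_.smul_apply, hψ, Matrix.mul_smul, Matrix.trace_smul, smul_eq_mul]
    rw [ad_pow_succ_apply, trace_tmul_comm_self hC, mul_zero]
  have hG0 : G 0 = ψ Y := by
    simp only [hG, pow_zero, zero_add, Nat.factorial_one, Nat.cast_one, inv_one, mul_one, one_smul, one_apply_eq_self]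
  have hsingle : HasSum G (ψ Y) := by
    rw [← hG0]
    exact hasSum_single 0 fun n hn => hzero n hn
  have h := hsum1.unique hsingle
  rwa [hψ, hψ] at h

/-- **`gauss_second_order` — THE SECOND-ORDER LETTER** [our proof]: for a normal `E`, `‖F‖ ≤ 1∕4` and `v` with `g(ad F)v = E` (the derivative equation of
the logarithm along an exponential curve, §1): `|tr(Eᵀ(v − E))| ≤ 10‖F‖²‖E‖²` — the first-order term `−½tr(Eᵀ[F,E])` vanishes, the rest is the tail
`Σ_{n≥2}(2‖F‖)ⁿ∕(n+1)!·‖E‖²` of the `g`-series plus `‖1 − g(ad F)‖²·‖v‖‖E‖`. -/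
theorem gauss_second_order {F v E : Matrix o o ℝ} (hEn : Eᵀ * E = E * Eᵀ) (hF : ‖F‖ ≤ 1 / 4)
    (hv : gSer ℝ (ad ℝ F) v = E) : |Matrix.trace (Eᵀ * (v - E))| ≤ 10 * ‖F‖ ^ 2 * ‖E‖ ^ 2 := by
  set T := ad ℝ F with hT
  have hF0 : 0 ≤ ‖F‖ := norm_nonneg F
  have hTn : ‖T‖ ≤ 2 * ‖F‖ := norm_ad_le F
  have hT1 : ‖T‖ ≤ 1 / 2 := by linarith
  have hg1 : ‖1 - gSer ℝ T‖ ≤ 2 * ‖F‖ := by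
    rw [norm_sub_rev]
    refine (norm_gSer_sub_one_le T).trans ?_
    have h := Real.abs_exp_sub_one_le (x := ‖T‖) (by rw [abs_of_nonneg (norm_nonneg _)]; linarith)
    rw [abs_of_nonneg (norm_nonneg _)] at h
    linarith [le_abs_self (Real.exp ‖T‖ - 1)]
  have hvE : (1 - gSer ℝ T) v = v - E := by
    rw [_root_.sub_apply, one_apply_eq_self, hv]
  have hvn : ‖v‖ ≤ 2 * ‖E‖ := by
    have h1 : ‖v - E‖ ≤ 2 * ‖F‖ * ‖v‖ := by
      rw [← hvE]; exact (ContinuousLinearMap.le_opNorm _ _).trans (mul_le_mul_of_nonneg_right hg1 (norm_nonneg _))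
    have h2 : ‖v‖ ≤ ‖v - E‖ + ‖E‖ := by
      have := norm_add_le (v - E) E; rwa [sub_add_cancel] at this
    nlinarith [norm_nonneg v]
  have hvEn : ‖v - E‖ ≤ 4 * ‖F‖ * ‖E‖ := by
    rw [← hvE]
    refine (ContinuousLinearMap.le_opNorm _ _).trans ?_
    calc ‖1 - gSer ℝ T‖ * ‖v‖ ≤ (2 * ‖F‖) * (2 * ‖E‖) := mul_le_mul hg1 hvn (norm_nonneg _) (by positivity)
      _ = 4 * ‖F‖ * ‖E‖ := by ring
  have hsplit : Matrix.trace (Eᵀ * (v - E)) =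
      Matrix.trace (Eᵀ * (1 - gSer ℝ T) E) + Matrix.trace (Eᵀ * (1 - gSer ℝ T) (v - E)) := by
    rw [← Matrix.trace_add, ← Matrix.mul_add, ← map_add, add_sub_cancel, hvE]
  -- the second piece
  have h2nd : |Matrix.trace (Eᵀ * (1 - gSer ℝ T) (v - E))| ≤ 8 * ‖F‖ ^ 2 * ‖E‖ ^ 2 := by
    refine (abs_trace_tmul_le _ _).trans ?_
    have h : ‖(1 - gSer ℝ T) (v - E)‖ ≤ (2 * ‖F‖) * (4 * ‖F‖ * ‖E‖) :=
      (ContinuousLinearMap.le_opNorm _ _).trans (mul_le_mul hg1 hvEn (norm_nonneg _) (by positivity))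
    calc ‖E‖ * ‖(1 - gSer ℝ T) (v - E)‖ ≤ ‖E‖ * ((2 * ‖F‖) * (4 * ‖F‖ * ‖E‖)) := mul_le_mul_of_nonneg_left h (norm_nonneg _)
      _ = 8 * ‖F‖ ^ 2 * ‖E‖ ^ 2 := by ring
  -- the first piece: the `g`-series paired with `E`
  have h1st : |Matrix.trace (Eᵀ * (1 - gSer ℝ T) E)| ≤ 4 / 3 * ‖F‖ ^ 2 * ‖E‖ ^ 2 := by
    let ψ := LinearMap.toContinuousLinearMap ((Matrix.traceLinearMap o ℝ ℝ).comp (LinearMap.mulLeft ℝ Eᵀ))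
    have hψ : ∀ X, ψ X = Matrix.trace (Eᵀ * X) := fun X => rfl
    set G : ℕ → ℝ := fun n => ψ ((((-1 : ℝ) ^ n * ((n + 1)! : ℝ)⁻¹) • T ^ n) E) with hG
    have hsum1 : HasSum G (ψ (gSer ℝ T E)) := by exact ψ.hasSum (hasSum_gSer_apply F E)
    have hsum2 := (hasSum_nat_add_iff' 2).mpr hsum1
    have e0 : G 0 = ‖E‖ ^ 2 := by
      simp only [hG, pow_zero, zero_add, Nat.factorial_one, Nat.cast_one, inv_one, mul_one, one_smul, one_apply_eq_self, hψ]
      exact trace_transpose_mul_self E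
    have e1 : G 1 = 0 := by
      simp only [hG, _root_.smul_apply, pow_one, hψ, hT, ad_apply, Matrix.mul_smul, Matrix.trace_smul, smul_eq_mul]
      rw [trace_tmul_comm_of_normal hEn, mul_zero]
    have e01 : ∑ i ∈ range 2, G i = ‖E‖ ^ 2 := by
      rw [Finset.sum_range_succ, Finset.sum_range_one, e0, e1, add_zero]
    rw [e01] at hsum2
    -- majorant `(2‖F‖)²‖E‖²∕6 · (1∕2)^m`
    have hgeo : HasSum (fun m : ℕ => (2 * ‖F‖) ^ 2 * ‖E‖ ^ 2 / 6 * (1 / 2 : ℝ) ^ m) ((2 * ‖F‖) ^ 2 * ‖E‖ ^ 2 / 6 * (1 - 1 / 2)⁻¹) :=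
      (hasSum_geometric_of_lt_one (by norm_num) (by norm_num)).mul_left _
    have hle : ∀ m : ℕ, ‖G (m + 2)‖ ≤ (2 * ‖F‖) ^ 2 * ‖E‖ ^ 2 / 6 * (1 / 2 : ℝ) ^ m := by
      intro m
      have hGm : G (m + 2) = ((-1 : ℝ) ^ (m + 2) * ((m + 2 + 1)! : ℝ)⁻¹) * Matrix.trace (Eᵀ * (T ^ (m + 2)) E) := by
        simp only [hG, _root_.smul_apply, hψ, Matrix.mul_smul, Matrix.trace_smul, smul_eq_mul]
      rw [hGm, Real.norm_eq_abs, abs_mul, abs_mul, abs_pow, abs_neg, abs_one, one_pow, one_mul, abs_inv, Nat.abs_cast]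
      have hfac : (6 : ℝ) ≤ ((m + 2 + 1)! : ℕ) := by
        have h : (3 : ℕ)! ≤ (m + 2 + 1)! := Nat.factorial_le (by omega)
        exact_mod_cast h
      have hfac' : (((m + 2 + 1)! : ℕ) : ℝ)⁻¹ ≤ 1 / 6 := by rw [one_div]; exact inv_anti₀ (by norm_num) hfac
      have hpow : ‖(T ^ (m + 2)) E‖ ≤ (2 * ‖F‖) ^ 2 * (1 / 2) ^ m * ‖E‖ := by
        refine (ContinuousLinearMap.le_opNorm _ _).trans (mul_le_mul_of_nonneg_right ?_ (norm_nonneg _))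
        calc ‖T ^ (m + 2)‖ ≤ ‖T‖ ^ (m + 2) := norm_pow_le' T (by omega)
          _ = ‖T‖ ^ 2 * ‖T‖ ^ m := by ring
          _ ≤ (2 * ‖F‖) ^ 2 * (1 / 2) ^ m :=
              mul_le_mul (pow_le_pow_left₀ (norm_nonneg _) hTn 2) (pow_le_pow_left₀ (norm_nonneg _) hT1 m) (by positivity) (by positivity)
      have habs := abs_trace_tmul_le E ((T ^ (m + 2)) E)
      calc (((m + 2 + 1)! : ℕ) : ℝ)⁻¹ * |Matrix.trace (Eᵀ * (T ^ (m + 2)) E)| ≤ 1 / 6 * (‖E‖ * ((2 * ‖F‖) ^ 2 * (1 / 2) ^ m * ‖E‖)) :=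
            mul_le_mul hfac' (habs.trans (mul_le_mul_of_nonneg_left hpow (norm_nonneg _))) (abs_nonneg _) (by norm_num)
        _ = (2 * ‖F‖) ^ 2 * ‖E‖ ^ 2 / 6 * (1 / 2 : ℝ) ^ m := by ring
    have hbound := hsum2.norm_le_of_bounded hgeo hle
    rw [Real.norm_eq_abs] at hbound
    have e : Matrix.trace (Eᵀ * (1 - gSer ℝ T) E) = ‖E‖ ^ 2 - ψ (gSer ℝ T E) := by
      rw [_root_.sub_apply, one_apply_eq_self, Matrix.mul_sub, Matrix.trace_sub, trace_transpose_mul_self, hψ]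
    rw [e, abs_sub_comm]
    refine hbound.trans (le_of_eq ?_)
    ring
  rw [hsplit]
  refine (abs_add_le _ _).trans ?_
  nlinarith [h1st, h2nd, sq_nonneg ‖F‖, sq_nonneg ‖E‖]

end Frobenius

/-! ## §3 The expansion of `½‖log(exp A · exp E)‖²` to second order in `E` (the Gauss lemma, integrated) -/

section Expansion

open scoped Matrix Matrix.Norms.Frobenius
open Matrix
open Summit.QuantumFields.BalabanUV.Beta.GAN24.DerivativeRateTransferJensenMassFreePolarNear
open Summit.QuantumFields.BalabanUV.Beta.GAN24.DerivativeRateTransferJensenMassFreeExpTaylor (orthogonal_exp_of_skew)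

variable {o : Type*} [Fintype o] [DecidableEq o]

omit [DecidableEq o] in
/-- `tr(XᵀE) = tr(EᵀX)`. [folklore] -/
theorem trace_tmul_comm' (X E : Matrix o o ℝ) : Matrix.trace (Xᵀ * E) = Matrix.trace (Eᵀ * X) := by
  rw [← Matrix.trace_transpose, transpose_mul, transpose_transpose]

/-- **`half_normSq_log_expansion` — THE GAUSS LEMMA, INTEGRATED** [our proof]: for SKEW `A, E` in the window `‖A‖ ≤ 1∕100`, `‖E‖ ≤ 1∕50` and the small
logarithm `C` of `exp A · exp E` (`‖C‖ ≤ 1∕4`):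
`|½‖C‖² − ½‖A‖² − tr(AᵀE) − ½‖E‖²| ≤ 10·(‖A‖ + (3∕2)‖E‖)²·‖E‖²`
— the squared geodesic length through second order, with NO term `‖A‖ᵏ‖E‖` beyond `tr(AᵀE)` (Gauss) and the remainder quadratic in `E` with a small
coefficient.  Proof: along `f(t) = log(exp A·exp(tE))` (§1), `Φ₁(t) = ½‖f‖² − ½‖A‖² − t·tr(AᵀE) − ½t²‖E‖²` has `Φ₁′ = tr(Eᵀ(f − A − tE)) =: Ψ₁` by the Gauss
lemma `tr(fᵀf′) = tr(fᵀ·g(ad f)f′) = tr(fᵀE)` (§2), `Ψ₁(0) = 0`, `|Ψ₁′| = |tr(Eᵀ(f′ − E))| ≤ 10‖f‖²‖E‖²` (§2), and the mean value inequality twice. -/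
theorem half_normSq_log_expansion {A E C : Matrix o o ℝ} (hAt : Aᵀ = -A) (hEt : Eᵀ = -E) (hA : ‖A‖ ≤ 1 / 100) (hE : ‖E‖ ≤ 1 / 50)
    (hC : ‖C‖ ≤ 1 / 4) (hCe : exp C = exp A * exp E) :
    |1 / 2 * ‖C‖ ^ 2 - 1 / 2 * ‖A‖ ^ 2 - Matrix.trace (Aᵀ * E) - 1 / 2 * ‖E‖ ^ 2| ≤ 10 * (‖A‖ + 3 / 2 * ‖E‖) ^ 2 * ‖E‖ ^ 2 := by
  obtain ⟨f, f', hf0, hf⟩ := exists_log_curve (𝔸 := Matrix o o ℝ) hA hE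
  set M : ℝ := ‖A‖ + 3 / 2 * ‖E‖ with hM
  set K : ℝ := 10 * M ^ 2 * ‖E‖ ^ 2 with hK
  have hEn : Eᵀ * E = E * Eᵀ := normal_of_skew hEt
  -- `f t` is skew on `[0,1]`
  have hft : ∀ t ∈ Icc (0 : ℝ) 1, (f t)ᵀ = -f t := by
    intro t ht
    obtain ⟨h4, he, -, -, -⟩ := hf t ht
    have htE : (t • E)ᵀ = -(t • E) := by rw [transpose_smul, hEt, smul_neg]
    have hG : (exp A * exp (t • E))ᵀ * (exp A * exp (t • E)) = 1 := by
      rw [transpose_mul, Matrix.mul_assoc, ← Matrix.mul_assoc (exp A)ᵀ, orthogonal_exp_of_skew hAt, Matrix.one_mul,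
        orthogonal_exp_of_skew htE]
    have hG1 : ‖exp A * exp (t • E) - 1‖ ≤ 1 / 8 := by
      have h := norm_exp_mul_exp_neg_sub_one_le_sixteenth hA (B := -(t • E))
        (by rw [norm_neg]; exact (norm_smul_le_of_mem_Icc ht).trans hE)
      rw [neg_neg] at h
      exact h.trans (by norm_num)
    obtain ⟨S, hSt, hS4, -, hSe⟩ := exists_skew_log_of_orthogonal hG hG1
    have hSf : S = f t := log_unique hS4 h4 (hSe.trans he.symm)
    rw [← hSf]; exact hSt
  -- `C = f 1`
  have h1 := hf 1 ⟨zero_le_one, le_rfl⟩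
  have hC1 : C = f 1 := by
    refine log_unique hC h1.1 (hCe.trans (h1.2.1.trans ?_).symm)
    rw [one_smul]
    rfl
  -- the two auxiliary functions
  have hd : ∀ t ∈ Icc (0 : ℝ) 1, HasDerivAt f (f' t) t := fun t ht => (hf t ht).2.2.1
  let trL := LinearMap.toContinuousLinearMap (Matrix.traceLinearMap o ℝ ℝ)
  have htrL : ∀ X : Matrix o o ℝ, trL X = Matrix.trace X := fun X => rfl
  let Φ₁ : ℝ → ℝ := fun t => -(1 / 2) * Matrix.trace (f t * f t) - 1 / 2 * ‖A‖ ^ 2 - t * Matrix.trace (Aᵀ * E) - 1 / 2 * t ^ 2 * ‖E‖ ^ 2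
  let Ψ₁ : ℝ → ℝ := fun t => Matrix.trace (Eᵀ * (f t - A - t • E))
  -- derivative of Ψ₁ and its bound
  have hΨ₁d : ∀ t ∈ Icc (0 : ℝ) 1, HasDerivAt Ψ₁ (Matrix.trace (Eᵀ * (f' t - (1 : ℝ) • E))) t := by
    intro t ht
    have hg : HasDerivAt (fun t => Eᵀ * (f t - A - t • E)) (Eᵀ * (f' t - (1 : ℝ) • E)) t :=
      (((hd t ht).sub_const A).sub ((hasDerivAt_id t).smul_const E)).const_mul (Eᵀ)
    have h := (trL.hasFDerivAt).comp_hasDerivAt t hg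
    exact h
  have hΨ₁b : ∀ t ∈ Icc (0 : ℝ) 1, ‖Matrix.trace (Eᵀ * (f' t - (1 : ℝ) • E))‖ ≤ K := by
    intro t ht
    obtain ⟨h4, -, -, hgs, hM'⟩ := hf t ht
    rw [one_smul, Real.norm_eq_abs]
    refine (gauss_second_order hEn h4 hgs).trans ?_
    have hfM : ‖f t‖ ^ 2 ≤ M ^ 2 := pow_le_pow_left₀ (norm_nonneg _) hM' 2
    rw [hK]
    nlinarith [sq_nonneg ‖E‖]
  -- `Ψ₁ 0 = 0` and `|Ψ₁ t| ≤ K` on `[0,1]`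
  have hΨ₁0 : Ψ₁ 0 = 0 := by
    show Matrix.trace (Eᵀ * (f 0 - A - (0 : ℝ) • E)) = 0
    rw [hf0, zero_smul, sub_self, sub_zero, Matrix.mul_zero, Matrix.trace_zero]
  have hΨ₁le : ∀ t ∈ Icc (0 : ℝ) 1, ‖Ψ₁ t‖ ≤ K := by
    intro t ht
    have h := norm_image_sub_le_of_norm_deriv_le_segment' (f := Ψ₁) (a := 0) (b := 1)
      (fun s hs => (hΨ₁d s hs).hasDerivWithinAt) (fun s hs => hΨ₁b s (Ico_subset_Icc_self hs)) t ht
    rw [hΨ₁0, sub_zero, sub_zero] at h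
    have hK0 : 0 ≤ K := by rw [hK]; positivity
    exact h.trans (mul_le_of_le_one_right hK0 ht.2)
  -- derivative of Φ₁ is Ψ₁
  have hΦ₁d : ∀ t ∈ Icc (0 : ℝ) 1, HasDerivAt Φ₁ (Ψ₁ t) t := by
    intro t ht
    obtain ⟨h4, -, -, hgs, -⟩ := hf t ht
    have hsq : HasDerivAt (fun t => f t * f t) (f' t * f t + f t * f' t) t := (hd t ht).mul (hd t ht)
    have htr : HasDerivAt (fun t => Matrix.trace (f t * f t)) (Matrix.trace (f' t * f t + f t * f' t)) t :=
      (trL.hasFDerivAt).comp_hasDerivAt t hsq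
    have hlin : HasDerivAt (fun t : ℝ => t * Matrix.trace (Aᵀ * E)) (1 * Matrix.trace (Aᵀ * E)) t := (hasDerivAt_id t).mul_const _
    have hquad : HasDerivAt (fun t : ℝ => 1 / 2 * t ^ 2 * ‖E‖ ^ 2) (1 / 2 * ((2 : ℕ) * t ^ (2 - 1)) * ‖E‖ ^ 2) t :=
      ((hasDerivAt_pow 2 t).const_mul (1 / 2)).mul_const _
    have hall := (((htr.const_mul (-(1 / 2))).sub_const (1 / 2 * ‖A‖ ^ 2)).sub hlin).sub hquad
    refine hall.congr_deriv ?_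
    -- the Gauss lemma: tr(fᵀ f′) = tr(fᵀ E)
    have hgauss : Matrix.trace ((f t)ᵀ * f' t) = Matrix.trace ((f t)ᵀ * E) :=
      (trace_tmul_gSer_ad_apply (normal_of_skew (hft t ht)) (f' t)).symm.trans (congrArg (fun X => Matrix.trace ((f t)ᵀ * X)) hgs)
    have e1 : Matrix.trace (f' t * f t + f t * f' t) = -(2 * Matrix.trace (Eᵀ * f t)) := by
      rw [Matrix.trace_add, Matrix.trace_mul_comm (f' t) (f t), ← trace_tmul_comm' (f t) E, ← hgauss, hft t ht, Matrix.neg_mul,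
        Matrix.trace_neg]
      ring
    have e2 : Matrix.trace (Aᵀ * E) = Matrix.trace (Eᵀ * A) := trace_tmul_comm' A E
    have e3 : ‖E‖ ^ 2 = Matrix.trace (Eᵀ * E) := (trace_transpose_mul_self E).symm
    show -(1 / 2) * Matrix.trace (f' t * f t + f t * f' t) - 1 * Matrix.trace (Aᵀ * E) - 1 / 2 * ((2 : ℕ) * t ^ (2 - 1)) * ‖E‖ ^ 2 =
      Matrix.trace (Eᵀ * (f t - A - t • E))
    rw [e1, e2, e3, Matrix.mul_sub, Matrix.mul_sub, Matrix.trace_sub, Matrix.trace_sub, Matrix.mul_smul, Matrix.trace_smul, smul_eq_mul]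
    push_cast
    ring
  -- `Φ₁ 0 = 0`, `Φ₁ 1` is the quantity to bound
  have hΦ₁0 : Φ₁ 0 = 0 := by
    show -(1 / 2) * Matrix.trace (f 0 * f 0) - 1 / 2 * ‖A‖ ^ 2 - 0 * Matrix.trace (Aᵀ * E) - 1 / 2 * (0 : ℝ) ^ 2 * ‖E‖ ^ 2 = 0
    have h : Matrix.trace (f 0 * f 0) = -‖A‖ ^ 2 := by
      rw [hf0, ← trace_transpose_mul_self, hAt, Matrix.neg_mul, Matrix.trace_neg, neg_neg]
    rw [h]; ring
  have hΦ₁1 : Φ₁ 1 = 1 / 2 * ‖C‖ ^ 2 - 1 / 2 * ‖A‖ ^ 2 - Matrix.trace (Aᵀ * E) - 1 / 2 * ‖E‖ ^ 2 := by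
    show -(1 / 2) * Matrix.trace (f 1 * f 1) - 1 / 2 * ‖A‖ ^ 2 - 1 * Matrix.trace (Aᵀ * E) - 1 / 2 * (1 : ℝ) ^ 2 * ‖E‖ ^ 2 = _
    have h : Matrix.trace (f 1 * f 1) = -‖C‖ ^ 2 := by
      rw [hC1, ← trace_transpose_mul_self, hft 1 ⟨zero_le_one, le_rfl⟩, Matrix.neg_mul, Matrix.trace_neg, neg_neg]
    rw [h]; ring
  have h := norm_image_sub_le_of_norm_deriv_le_segment_01' (f := Φ₁)
    (fun s hs => (hΦ₁d s hs).hasDerivWithinAt) (fun s hs => hΨ₁le s (Ico_subset_Icc_self hs))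
  rw [hΦ₁0, sub_zero, hΦ₁1, Real.norm_eq_abs] at h
  exact h

end Expansion

end Summit.QuantumFields.BalabanUV.Beta.GAN24.DerivativeRateTransferJensenMassFreeKarcherGauss

end
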